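import Literature.Computability.QuantumComplexity.IQPForrelation
import Literature.Computability.QuantumComplexity.ForrelationDirectSum

/-!
# `NearExactIsExact` (stmt-QuantumAdvantage-14043), line `direct-sum-amplification` — McFarland's Walsh sum (F1)

Stub `stub_mmWalsh` of the line `direct-sum-amplification` for the crux
`Summit.QuantumAdvantage.QuantumAdvantage.Theses.CubicForrelation.NearExactIsExact`.

**What.** Let `g : 𝔽₂^{m+m} → 𝔽₂` be in Maiorana–McFarland SIGN FORM with respect to an ARBITRARY map
`π : 𝔽₂^m → 𝔽₂^m` and an arbitrary `h : 𝔽₂^m → 𝔽₂`, i.e. `(-1)^{g(y₁ ‖ y₂)} = (-1)^{y₁·π(y₂)} (-1)^{h(y₂)}`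
(no bijectivity of `π`, no degree hypotheses). Then for every `f : 𝔽₂^{m+m} → 𝔽₂`

  `Φ(f, g) = 2^{-2m} ∑_{y₂} (-1)^{h(y₂)} ∑_{x₂} (-1)^{f(π(y₂) ‖ x₂)} (-1)^{x₂·y₂}`      (`stub_mmWalsh`),

the average over `y₂` of the signed, `y₂`-twisted bias of `f` on the fibre `{x₁ = π(y₂)}`.

**Proof.** A pure finite-sum identity. Summing over the linear block `y₁` first, character orthogonality
(`BuzetChailloux.sum_twist_left`, `twist_bxor_right`, `bxor_eq_zeroVec_iff`) gives McFarland's dual sum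
`∑_y (-1)^{(x₁‖x₂)·y} (-1)^{g(y)} = 2^m ∑_{y₂ : π(y₂) = x₁} (-1)^{x₂·y₂} (-1)^{h(y₂)}` (`mw_walsh_signForm`, via
`sum_append`, `twist_append`); then the sum over `x₁` collapses (`Finset.sum_ite_eq`), and the normalisation is
`√(2^{3(m+m)}) = 2^m · 2^{2m}`. The `m = 8`, `π` bijective instance is the landed `Negative.W_g16` /
`Negative.fsum_f16_g16` / `Negative.forrelation_f16_g16`; the moves are the same.

References (orientation only; everything here is proved): R. L. McFarland, A family of difference sets in
non-cyclic groups, JCTA 15 (1973); J. F. Dillon, Elementary Hadamard difference sets (1974), Ch. 5;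
R. O'Donnell, Analysis of Boolean Functions (2014), §1.4 (orthogonality of characters).
-/

set_option linter.dupNamespace false -- D-0017: single-problem summit

namespace Summit.QuantumAdvantage.QuantumAdvantage.Theorems.CubicForrelation.NearExactIsExact

open Finset
open Literature.Computability.QuantumComplexity
open Literature.Computability.QuantumComplexity.BuzetChailloux (bxor zeroVec signOf_sq)

/-- **Character orthogonality on the linear block**: `∑_{y₁} (-1)^{x₁·y₁} (-1)^{y₁·z} = 2^m [z = x₁]`.
[folklore] -/
theorem mw_sum_linear_block {m : ℕ} (x₁ z : Fin m → Bool) :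
    ∑ y₁ : Fin m → Bool, twist x₁ y₁ * twist y₁ z = if z = x₁ then (2 : ℝ) ^ m else 0 := by
  have e : ∀ y₁ : Fin m → Bool, twist x₁ y₁ * twist y₁ z = twist y₁ (bxor x₁ z) := by
    intro y₁
    rw [BuzetChailloux.twist_bxor_right, twist_comm x₁ y₁]
  rw [sum_congr rfl fun y₁ _ => e y₁, BuzetChailloux.sum_twist_left]
  refine if_congr ?_ rfl rfl
  rw [BuzetChailloux.bxor_eq_zeroVec_iff]
  exact eq_comm

/-- **McFarland's dual sum** for a Maiorana–McFarland sign form with an arbitrary map `π`: for `x = x₁ ‖ x₂`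
and any scalar `c`, `∑_y c (-1)^{x·y} (-1)^{g(y)} = 2^m ∑_{y₂ : π(y₂) = x₁} c (-1)^{x₂·y₂} (-1)^{h(y₂)}` — the sum
over the linear block `y₁` is `2^m [π(y₂) = x₁]` (`mw_sum_linear_block`). [folklore] -/
theorem mw_walsh_signForm {m : ℕ} (g : (Fin (m + m) → Bool) → Bool) (π : (Fin m → Bool) → (Fin m → Bool))
    (h : (Fin m → Bool) → Bool)
    (hg : ∀ y₁ y₂ : Fin m → Bool, signOf (g (Fin.append y₁ y₂)) = twist y₁ (π y₂) * signOf (h y₂))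
    (c : ℝ) (x₁ x₂ : Fin m → Bool) :
    ∑ y : Fin (m + m) → Bool, c * twist (Fin.append x₁ x₂) y * signOf (g y) =
      (2 : ℝ) ^ m * ∑ y₂ : Fin m → Bool, (if π y₂ = x₁ then c * twist x₂ y₂ * signOf (h y₂) else 0) := by
  rw [sum_append, Finset.sum_comm, mul_sum]
  refine sum_congr rfl fun y₂ _ => ?_
  have e : ∀ y₁ : Fin m → Bool,
      c * twist (Fin.append x₁ x₂) (Fin.append y₁ y₂) * signOf (g (Fin.append y₁ y₂)) =
        c * twist x₂ y₂ * signOf (h y₂) * (twist x₁ y₁ * twist y₁ (π y₂)) := by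
    intro y₁
    rw [twist_append, hg]
    ring
  rw [sum_congr rfl fun y₁ _ => e y₁, ← mul_sum, mw_sum_linear_block]
  split_ifs <;> ring

/-- **The unnormalised forrelation sum of a Maiorana–McFarland sign form**:
`∑_{x,y} (-1)^{f(x)} (-1)^{x·y} (-1)^{g(y)} = 2^m ∑_{y₂} (-1)^{h(y₂)} ∑_{x₂} (-1)^{f(π(y₂) ‖ x₂)} (-1)^{x₂·y₂}`
(McFarland's dual sum `mw_walsh_signForm`, then the sum over `x₁` collapses onto `x₁ = π(y₂)`). [folklore] -/
theorem mw_fsum_signForm {m : ℕ} (f g : (Fin (m + m) → Bool) → Bool) (π : (Fin m → Bool) → (Fin m → Bool))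
    (h : (Fin m → Bool) → Bool)
    (hg : ∀ y₁ y₂ : Fin m → Bool, signOf (g (Fin.append y₁ y₂)) = twist y₁ (π y₂) * signOf (h y₂)) :
    ∑ x : Fin (m + m) → Bool, ∑ y : Fin (m + m) → Bool, signOf (f x) * twist x y * signOf (g y) =
      (2 : ℝ) ^ m * ∑ y₂ : Fin m → Bool, signOf (h y₂) *
        ∑ x₂ : Fin m → Bool, signOf (f (Fin.append (π y₂) x₂)) * twist x₂ y₂ := by
  calc ∑ x : Fin (m + m) → Bool, ∑ y : Fin (m + m) → Bool, signOf (f x) * twist x y * signOf (g y)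
      = ∑ x₁ : Fin m → Bool, ∑ x₂ : Fin m → Bool, (2 : ℝ) ^ m * ∑ y₂ : Fin m → Bool,
          (if π y₂ = x₁ then signOf (f (Fin.append x₁ x₂)) * twist x₂ y₂ * signOf (h y₂) else 0) := by
        rw [sum_append]
        exact sum_congr rfl fun x₁ _ => sum_congr rfl fun x₂ _ => mw_walsh_signForm g π h hg _ x₁ x₂
    _ = (2 : ℝ) ^ m * ∑ x₂ : Fin m → Bool, ∑ x₁ : Fin m → Bool, ∑ y₂ : Fin m → Bool,
          (if π y₂ = x₁ then signOf (f (Fin.append x₁ x₂)) * twist x₂ y₂ * signOf (h y₂) else 0) := by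
        rw [mul_sum, Finset.sum_comm]
        exact sum_congr rfl fun x₂ _ => (mul_sum _ _ _).symm
    _ = (2 : ℝ) ^ m * ∑ x₂ : Fin m → Bool, ∑ y₂ : Fin m → Bool,
          signOf (f (Fin.append (π y₂) x₂)) * twist x₂ y₂ * signOf (h y₂) := by
        congr 1
        refine sum_congr rfl fun x₂ _ => ?_
        rw [Finset.sum_comm]
        refine sum_congr rfl fun y₂ _ => ?_
        rw [Finset.sum_ite_eq, if_pos (mem_univ _)]
    _ = (2 : ℝ) ^ m * ∑ y₂ : Fin m → Bool, signOf (h y₂) *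
          ∑ x₂ : Fin m → Bool, signOf (f (Fin.append (π y₂) x₂)) * twist x₂ y₂ := by
        rw [Finset.sum_comm]
        congr 1
        refine sum_congr rfl fun y₂ _ => ?_
        rw [mul_sum]
        refine sum_congr rfl fun x₂ _ => ?_
        ring

/-- The normalisation of `Φ` on `m + m` bits: `√(2^{3(m+m)}) = 2^m · 2^{2m}`. [folklore] -/
theorem mw_sqrt_two_pow (m : ℕ) : Real.sqrt ((2 : ℝ) ^ (3 * (m + m))) = (2 : ℝ) ^ m * (2 : ℝ) ^ (2 * m) := by
  rw [show (2 : ℝ) ^ (3 * (m + m)) = ((2 : ℝ) ^ m * (2 : ℝ) ^ (2 * m)) ^ 2 by ring,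
    Real.sqrt_sq (by positivity)]

/-- **McFarland's Walsh sum for a Maiorana–McFarland sign form** (stub `stub_mmWalsh`, tag F1, of the line
`direct-sum-amplification`). If `(-1)^{g(y₁ ‖ y₂)} = (-1)^{y₁·π(y₂)} (-1)^{h(y₂)}` for an ARBITRARY map `π` (no
bijectivity, no degree hypotheses), then for every `f`

  `Φ(f, g) = 2^{-2m} ∑_{y₂} (-1)^{h(y₂)} ∑_{x₂} (-1)^{f(π(y₂) ‖ x₂)} (-1)^{x₂·y₂}`:

summing over the linear block `y₁` first gives `W_{(-1)^g}(x₁ ‖ x₂) = 2^m ∑_{y₂ : π(y₂) = x₁} (-1)^{h(y₂)} (-1)^{x₂·y₂}`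
(`mw_walsh_signForm`), the sum over `x₁` collapses (`mw_fsum_signForm`), and `√(2^{3(m+m)}) = 2^m · 2^{2m}`
(`mw_sqrt_two_pow`). The `m = 8` instance is `Negative.forrelation_f16_g16`. [folklore] -/
theorem stub_mmWalsh :
    ∀ (m : ℕ) (f g : (Fin (m + m) → Bool) → Bool) (π : (Fin m → Bool) → (Fin m → Bool)) (h : (Fin m → Bool) → Bool),
      (∀ y₁ y₂ : Fin m → Bool, signOf (g (Fin.append y₁ y₂)) = twist y₁ (π y₂) * signOf (h y₂)) →
      forrelation f g = ((2 : ℝ) ^ (2 * m))⁻¹ *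
        ∑ y₂ : Fin m → Bool, signOf (h y₂) * ∑ x₂ : Fin m → Bool, signOf (f (Fin.append (π y₂) x₂)) * twist x₂ y₂ := by
  intro m f g π h hg
  unfold forrelation
  rw [mw_fsum_signForm f g π h hg, mw_sqrt_two_pow, mul_inv, mul_mul_mul_comm,
    inv_mul_cancel₀ (by positivity : (2 : ℝ) ^ m ≠ 0), one_mul]

end Summit.QuantumAdvantage.QuantumAdvantage.Theorems.CubicForrelation.NearExactIsExact
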